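import Mathlib
import Summits.ResolutionOfSingularities.ResolutionOfSingularities.Theorems.RadicialJungCleanModelsCleanLU3ArcCoreOrder
import HarnessLib

/-!
# Route `RadicialJung`, crux `CleanModels` (stmt-15917), stub `stub_cleanLU3DefectArcInfinite`: preliminaries for the wrapper —
# non-vanishing of some dual derivative, transport of a generating triple along an equality of subrings, approximability of `h`

Line `Sketch` rev 20 of crux stmt-ResolutionOfSingularities-15917; lead `res-B-lead-1` g3.  OURS; nothing here proves resolution in
characteristic `p`.

* `exists_dual_apply_ne_zero` — if SOME derivation-multiple `s • Δ` preserving `R₀` moves `h`, then one of the dual derivations `E_l`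
  (`E_l a_m = e δ_{lm}`) moves `h` (chain rule on the `Q`-constant representation of `h`, `Q` large).
* `maximalIdeal_eq_span_of_eq` — transport of `𝔪 = (π, y, z)` along an equality of subrings.
* `forall_exists_valuation_sub_pow_le` — no best `p`-th-power approximation along a discrete valuation ⟹ `h = b^p g₀` is a `p`-th power to
  every order.
-/

noncomputable section

set_option linter.dupNamespace false -- mandated namespace of this single-conjunct summit

open IsLocalRing Polynomial
open Literature.AlgebraicGeometry.Resolution

namespace Summit.ResolutionOfSingularities.ResolutionOfSingularities.Theorems.RadicialJung.CleanModels

variable {K : Type} [Field K]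

/-- **Some dual derivative of `h` is nonzero** when some derivation-multiple preserving `R₀` moves `h` (perfect residue field,
`𝔪₀ = (a_l)`, `E_l a_m = e δ_{lm}` with `e` a unit). [folklore] -/
theorem exists_dual_apply_ne_zero {O : ValuationSubring K} {p : ℕ} [hp : Fact p.Prime] [CharP K p]
    {R : Subring K} [IsLocalRing R] (hdom : SubringDominates R O.toSubring)
    (π : K) (hπ : ∀ x : K, O.valuation x < 1 → O.valuation x ≤ O.valuation π)
    (harch : ∀ x : K, x ≠ 0 → ∃ n : ℕ, O.valuation π ^ n ≤ O.valuation x) (hvπ : O.valuation π < 1) (hπ0 : π ≠ 0)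
    {n : ℕ} (a : Fin n → K) (haR : ∀ l, a l ∈ R) (hm : maximalIdeal R = Ideal.span (Set.range fun l => (⟨a l, haR l⟩ : R)))
    (hperf : ∀ b : K, b ∈ R → ∃ t : K, t ∈ R ∧ O.valuation (b - t ^ p) < 1)
    (E : Fin n → Derivation ℤ K K) (hE : ∀ l y, y ∈ R → E l y ∈ R) (e : K) (hve : O.valuation e = 1)
    (hdual : ∀ l m, E l (a m) = if l = m then e else 0)
    (Δ : Derivation ℤ K K) (s : K) (hΔ : ∀ y ∈ R, s * Δ y ∈ R) (h : K) (hh : h ∈ R) (hΔh : s * Δ h ≠ 0) :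
    ∃ l, E l h ≠ 0 := by
  classical
  by_contra hall
  push Not at hall
  have hle1 : ∀ z : K, z ∈ R → O.valuation z ≤ 1 := fun z hz => (O.valuation_le_one_iff _).mpr (hdom.1 hz)
  have hvπ1 : O.valuation π ≤ 1 := hvπ.le
  have hanti : ∀ {i j : ℕ}, i ≤ j → O.valuation π ^ j ≤ O.valuation π ^ i := fun hij => pow_le_pow_right_of_le_one' hvπ1 hij
  -- `Q = p^(N+2)` with `v π ^ N ≤ v (s Δ h)`
  obtain ⟨N, hN⟩ := harch _ hΔh
  set sQ : ℕ := N + 2 with hsQ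
  have hs0 : sQ ≠ 0 := by omega
  have hQN : N + 2 < p ^ sQ := Nat.lt_pow_self hp.out.one_lt
  obtain ⟨H, mQ, hmQ, hrep⟩ := exists_mvPolynomial_rep hdom hperf sQ (fun l => (⟨a l, haR l⟩ : R)) hm (p ^ sQ) ⟨h, hh⟩
  let hl : Fin n → K := fun l => MvPolynomial.aeval a (MvPolynomial.pderiv l H)
  have hchain : ∀ D : Derivation ℤ K K, D (MvPolynomial.aeval a H) = ∑ m, hl m * D (a m) := fun D =>
    MvPolynomial.derivation_aeval_eq_sum D (fun t => derivation_apply_qconst D R hs0 t) a H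
  have hrep' : h = MvPolynomial.aeval a H + (mQ : K) := hrep
  -- `v (D mQ) ≤ v π ^ (Q - 1)` for every `D` with `s' • D` preserving `R`
  have hvDm : ∀ (D : Derivation ℤ K K) (s' : K), (∀ y ∈ R, s' * D y ∈ R) →
      O.valuation (s' * D (mQ : K)) ≤ O.valuation π ^ (p ^ sQ - 1) := by
    intro D s' hD
    have hps : p ^ sQ = (p ^ sQ - 1) + 1 := by omega
    have h1 := derivation_apply_mem_pow D s' hD (p ^ sQ - 1) mQ (hps ▸ hmQ)
    exact valuation_le_pow_of_mem_pow hdom π hπ _ _ h1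
  -- all `h_l` are small
  have hvhl : ∀ l, O.valuation (hl l) ≤ O.valuation π ^ (p ^ sQ - 1) := by
    intro l
    have hEl : E l h = hl l * e + E l (mQ : K) := by
      rw [hrep', map_add, hchain]
      simp_rw [hdual l, mul_ite, mul_zero, Finset.sum_ite_eq, Finset.mem_univ, if_true]
    have e1 : hl l = -(E l (mQ : K)) * e⁻¹ := by
      have := hall l; rw [hEl] at this
      field_simp [ne_zero_of_valuation_eq_one hve]
      linear_combination this
    rw [e1, map_mul, Valuation.map_neg, map_inv₀, hve, inv_one, mul_one]
    have := hvDm (E l) 1 (fun y hy => by rw [one_mul]; exact hE l y hy)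
    rwa [one_mul] at this
  -- hence `s Δ h` is small: contradiction
  have hsR : ∀ m, O.valuation (s * Δ (a m)) ≤ 1 := fun m => hle1 _ (hΔ _ (haR m))
  have hv : O.valuation (s * Δ h) ≤ O.valuation π ^ (p ^ sQ - 1) := by
    have e1 : s * Δ h = ∑ m, hl m * (s * Δ (a m)) + s * Δ (mQ : K) := by
      rw [hrep', map_add, mul_add, hchain, Finset.mul_sum]
      congr 1
      exact Finset.sum_congr rfl fun m _ => by ring
    rw [e1]
    refine (Valuation.map_add _ _ _).trans (max_le (Valuation.map_sum_le _ fun m _ => ?_) (hvDm Δ s hΔ))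
    rw [map_mul]
    calc O.valuation (hl m) * O.valuation (s * Δ (a m)) ≤ O.valuation π ^ (p ^ sQ - 1) * 1 := mul_le_mul' (hvhl m) (hsR m)
      _ = O.valuation π ^ (p ^ sQ - 1) := mul_one _
  have hlt : O.valuation π ^ (p ^ sQ - 1) < O.valuation π ^ N := valuation_pow_lt_pow O π hπ0 hvπ (by omega)
  exact absurd (hN.trans hv) (not_le.mpr hlt)

/-- Transport of a generating triple of the maximal ideal along an equality of subrings. [folklore] -/
theorem maximalIdeal_eq_span_of_eq {S S' : Subring K} (hSS' : S = S') [hS : IsLocalRing S] [hS' : IsLocalRing S']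
    (π y z : K) (hπ : π ∈ S) (hy : y ∈ S) (hz : z ∈ S)
    (h : maximalIdeal S = Ideal.span {(⟨π, hπ⟩ : S), ⟨y, hy⟩, ⟨z, hz⟩}) :
    maximalIdeal S' = Ideal.span {(⟨π, hSS' ▸ hπ⟩ : S'), ⟨y, hSS' ▸ hy⟩, ⟨z, hSS' ▸ hz⟩} := by
  subst hSS'
  convert h

/-- Transport of the Krull dimension along an equality of subrings. [folklore] -/
theorem ringKrullDim_eq_of_subring_eq {S S' : Subring K} (hSS' : S = S') {d : WithBot ℕ∞} (h : ringKrullDim S = d) :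
    ringKrullDim S' = d := by
  subst hSS'; exact h

/-- **`h = b^p g₀` is a `p`-th power to every order** when `g₀` has no best `p`-th-power approximation along a valuation with
value-generator `π` and `h ∈ O`. [folklore] -/
theorem forall_exists_valuation_sub_pow_le (O : ValuationSubring K) (π : K) {p : ℕ} (hp : p ≠ 0)
    (hπ : ∀ x : K, O.valuation x < 1 → O.valuation x ≤ O.valuation π) (g₀ b : K)
    (hdefect : ∀ f₀ : K, ∃ f₁ : K, O.valuation (g₀ - f₁ ^ p) < O.valuation (g₀ - f₀ ^ p))
    (hhO : O.valuation (b ^ p * g₀) ≤ 1) :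
    ∀ N : ℕ, ∃ bb : K, O.valuation (b ^ p * g₀ - bb ^ p) ≤ O.valuation π ^ N := by
  intro N
  obtain ⟨f, hf⟩ := exists_approx_le_pow_of_forall_exists_lt O π hπ g₀ hdefect hp N
  refine ⟨b * f, ?_⟩
  have e1 : b ^ p * g₀ - (b * f) ^ p = b ^ p * (g₀ - f ^ p) := by ring
  rw [e1, map_mul]
  calc O.valuation (b ^ p) * O.valuation (g₀ - f ^ p) ≤ O.valuation (b ^ p) * (O.valuation π ^ N * O.valuation g₀) :=
        mul_le_mul_right hf _
    _ = O.valuation π ^ N * O.valuation (b ^ p * g₀) := by rw [map_mul, mul_left_comm]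
    _ ≤ O.valuation π ^ N * 1 := mul_le_mul_right hhO _
    _ = O.valuation π ^ N := mul_one _

end Summit.ResolutionOfSingularities.ResolutionOfSingularities.Theorems.RadicialJung.CleanModels

end
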